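import Summits.QuantumFields.BalabanUV.T4Continuum.Support.NE3EnergyShapes
import Summits.QuantumFields.BalabanUV.T4Continuum.Support.NE3EnergyPath

/-!
# T⁴ programme, node NE3, route P2 «ENERGY CONVEXITY» — THE TORUS ASSEMBLY (typer row Y0): the conjunction of the
# route's LEAVES at a pair of minimisers implies the typed ROOT `NE3EnergyShapes.NE3EnergyRate`, kernel-checked

Eleventh generation of the NE3 prover lineage P2 (unit `b2b-balaban-t4-ne3-p2`; ROUND-2 SKELETON-FIRST mandate), row Y0
of the skeleton `HOME/t4/skeletons/NE3-t4-ne3-p2.md`.  WHAT THIS FILE CERTIFIES.  The skeleton's claim «NO LEAF IS THE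
ESTIMATE IN DISGUISE; the leaves L1–L9 imply the root T-E» as a KERNEL IMPLICATION over the tree's torus objects: the
structure `RouteLeaves` (§1) lists, for ONE pair (run-A minimiser `U_A`, run-B minimiser `U_B`) and the background
`W := cavg L U_B`, exactly the leaf statements — (L1 REP) a periodic `U(N)` gauge `u` and a path `Γ : ℝ → directions`
with `U_A^u = W·exp Γ(0)`; (L2 PATH) admissibility of `W·exp Γ(t)` in run A's fibre and class for `t ∈ [0,1]`, the
tangent part `X ∈ T` of the velocity, the non-tangent part `N(u_t) ≤ θ N(X)`, the end-point closeness
`N(Γ 0) ≤ (1+θ₀) N(X)`; (L3 C2) `φ(t) = A_{period}(W·exp Γ(t))` with derivatives `φ′, φ″` on `[0,1]`; (L4+L6 HESS∕CONT)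
the splitting `φ″ = Hs_t[X + u_t, X + u_t] + e_t` with `Hs_t` symmetric and `Λ`-continuous in the energy norm; (L5 COERC)
`c`-coercivity of `Hs_t` on `T`; (L7+L2 SRC) `|e_t| ≤ κ N(X)²`; (L9∕Y9 RES) the end-point derivative bound
`φ′(1) ≤ r·N(X)` (supplied by `Support/NE3EnergyResidual.abs_deriv_action_le_residualScale` with `r = residualScale`
once L2 identifies `φ′(1)` with `−d/ds|₀ A(W e^{sX})`); plus the folklore gauge invariance of the Wilson action (§2,
PROVED here: `fineAction_gaugeAct`).  THEN (§3 **`energyNorm_le_of_routeLeaves`**, **`ne3EnergyRate_of_routeLeaves`**):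
minimality of `U_A` (`IsMinimiser`, the owner's p204506) gives `φ(0) ≤ φ(t)`, `Support/NE3EnergyPath.energyResponse_of_pathData`
(p206756) gives `N(X) ≤ r/m`, `m = c − 2Λθ − Λθ² − κ ≥ c/2` under the budget, hence
`energyNorm W (Γ 0) ≤ (1+θ₀)·(2/c)·r`, i.e. `NE3EnergyRate 𝒞 L N b g ((1+θ₀)·(2/c)) dom` when the leaves hold with
`r = residualScale d L N b g k` uniformly over the minimiser pairs of `dom`.  Non-vacuity of the ROOT itself is
`NE3EnergyShapes.ne3EnergyRate_flat`; `RouteLeaves` is satisfiable trivially (flat data, `Γ ≡ 0`, `X = 0`, `T = {0}`,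
all forms zero) — a witness the typer may add; nothing here depends on it.

HONEST FRAMING.  Finite-T⁴ bookkeeping (rung (B)+1).  This file PROVES AN IMPLICATION: leaves ⇒ root; it proves NO
leaf for Bałaban's minimisers (L1–L8 are open rows of the skeleton; L9 is row NE3-R2's theorem) and therefore does NOT
prove NE3; no conditional of the cell is used or hidden; NOT infinite volume ∕ mass gap ∕ Clay ∕ summit progress.
ABSOLUTE RULE kept: no printed sentence is a hypothesis (context: [Balaban1985Variational] (19)–(21) p. 281, (47) p. 285,
(74)–(84) pp. 289–290, §E p. 295).  PLACEMENT: `Summits/QuantumFields/BalabanUV/`; imports the accepted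
`Support.NE3EnergyPath` (p206756) and `Support.NE3EnergyShapes`; moves nothing.
-/

set_option autoImplicit false

open scoped BigOperators Matrix Matrix.Norms.L2Operator
open NormedSpace Finset

namespace Summit.QuantumFields.BalabanUV.T4Continuum.NE3EnergyAssembly

open Set
open Literature.MathematicalPhysics.QuantumFieldTheory.Balaban1983to89
open B7Prop1Explicit B7Prop2Explicit MatrixLog UnitaryModel
open T4AveragingDeficitWall hiding Site Plane Plaq Bond
open T4AveragingDeficitWallBoundary (IsPeriodicCfg periodBox)
open AveragingDeficitPeriodicCounting (IsPeriodicDir)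
open AveragingDeficitChartCalculus (cavg)
open MinimalActionLevels (perWin levelAction stepWt stepWt_pos)
open MinimalActionSandwich (IsMinimiser admissible)
open MinimalActionRate (Regular)
open NE3EnergyShapes (energyNorm energyNorm_nonneg residualScale residualScale_nonneg IsUnitarySite IsPeriodicSite NE3EnergyRate)
open NE3EnergyPath (energyResponse_of_pathData modulus_ge_half strongConvexity_along_path)

noncomputable section

variable {d : ℕ} {n : Type*} [Fintype n] [DecidableEq n]

/-! ## §1 The leaves of the route at one pair of minimisers, as one hypothesis structure -/

/-- **THE ROUTE'S LEAVES AT ONE PAIR** `(U_A, U_B)` of run-A ∕ run-B configurations of the datum `V` (level `k`, class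
`𝒞`, torus side `N`), with background `W := cavg L U_B`, period `P := N·L^k`, energy norm `N_W(·) := energyNorm W · [0,P)^d`
and constants `(c, Λ, θ, κ, θ₀, r)`.  DATA: gauge `u`, tangent direction `X`, path of directions `Γ`, the action along the
path `φ` with derivatives `φ′ φ″`, the Hessian forms `Hs t`, the non-tangent velocity `uu t`, the curvature term `e t`,
the tangent space `T`.  FIELDS = the skeleton's leaves L1 (rep, gauge), L2 (adm, tangent, velocity, close), L3 (act, d1,
d2), L4+L6 (symm, split, cont), L5 (coer), L7 (curv), L9∕Y9 (res).  A SHAPE: asserted for no configuration of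
Bałaban's; the swarm's leaf rows discharge the fields. [folklore] -/
@[folklore]
structure RouteLeaves (𝒞 : ℕ → Set (B7Prop1Explicit.Site d → Fin d → (Matrix n n ℂ)ˣ)) (L N k : ℕ)
    (V UA UB : B7Prop1Explicit.Site d → Fin d → (Matrix n n ℂ)ˣ)
    (u : B7Prop1Explicit.Site d → (Matrix n n ℂ)ˣ) (X : B7Prop1Explicit.Site d → Fin d → Matrix n n ℂ)
    (Γ : ℝ → B7Prop1Explicit.Site d → Fin d → Matrix n n ℂ) (φ φ' φ'' : ℝ → ℝ)
    (Hs : ℝ → (B7Prop1Explicit.Site d → Fin d → Matrix n n ℂ) →ₗ[ℝ]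
      (B7Prop1Explicit.Site d → Fin d → Matrix n n ℂ) →ₗ[ℝ] ℝ)
    (uu : ℝ → B7Prop1Explicit.Site d → Fin d → Matrix n n ℂ) (e : ℝ → ℝ)
    (T : Set (B7Prop1Explicit.Site d → Fin d → Matrix n n ℂ)) (c Λ θ κ θ₀ r : ℝ) : Prop where
  /-- L1 REP: the gauge transformation is `U(N)`-valued and periodic -/
  gauge : IsUnitarySite u ∧ IsPeriodicSite u ((N * L ^ k : ℕ) : ℤ)
  /-- L1 REP: `U_A^u = W·exp Γ(0)` -/
  rep : gaugeAct u UA = vary (cavg L UB) (Γ 0) 1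
  /-- L2 PATH: the path ends at the background `W` itself: `Γ(1) = 0` -/
  endW : Γ 1 = 0
  /-- L1 REP: the end-point direction is `𝔲(N)`-valued and periodic -/
  dirZ : IsSkewDir (Γ 0) ∧ IsPeriodicDir (Γ 0) ((N * L ^ k : ℕ) : ℤ)
  /-- L2 PATH: the path stays in run A's fibre and class -/
  adm : ∀ t ∈ Icc (0:ℝ) 1, vary (cavg L UB) (Γ t) 1 ∈ admissible 𝒞 L k V
  /-- L2 PATH: the tangent part of the velocity lies in the tangent space -/
  tangent : X ∈ T
  /-- L2 PATH (b): the non-tangent part of the velocity is `θ`-small -/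
  velocity : ∀ t ∈ Icc (0:ℝ) 1,
    energyNorm (cavg L UB) (uu t) (periodBox (N * L ^ k)) ≤ θ * energyNorm (cavg L UB) X (periodBox (N * L ^ k))
  /-- L2 PATH (b): the end-point direction is `(1+θ₀)`-close to the tangent part in the energy norm -/
  close : energyNorm (cavg L UB) (Γ 0) (periodBox (N * L ^ k))
    ≤ (1 + θ₀) * energyNorm (cavg L UB) X (periodBox (N * L ^ k))
  /-- L3 C2: `φ` is the run-A Wilson action of one period along the path -/
  act : ∀ t, φ t = fineAction (vary (cavg L UB) (Γ t) 1) (perWin d (N * L ^ k))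
  /-- L3 C2: first derivative -/
  d1 : ∀ t ∈ Icc (0:ℝ) 1, HasDerivAt φ (φ' t) t
  /-- L3 C2: second derivative -/
  d2 : ∀ t ∈ Icc (0:ℝ) 1, HasDerivAt φ' (φ'' t) t
  /-- L4 HESS: the Hessian forms are symmetric -/
  symm : ∀ t ∈ Icc (0:ℝ) 1, ∀ x y, Hs t x y = Hs t y x
  /-- L4 HESS: the second derivative splits into Hessian + curvature term -/
  split : ∀ t ∈ Icc (0:ℝ) 1, φ'' t = Hs t (X + uu t) (X + uu t) + e t
  /-- L5 COERC: tangent coercivity in the energy norm (ML at the unit scale) -/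
  coer : ∀ t ∈ Icc (0:ℝ) 1, ∀ Y ∈ T, c * energyNorm (cavg L UB) Y (periodBox (N * L ^ k)) ^ 2 ≤ Hs t Y Y
  /-- L6 CONT: continuity of the Hessian in the energy norm -/
  cont : ∀ t ∈ Icc (0:ℝ) 1, ∀ Y Z, |Hs t Y Z|
    ≤ Λ * energyNorm (cavg L UB) Y (periodBox (N * L ^ k)) * energyNorm (cavg L UB) Z (periodBox (N * L ^ k))
  /-- L7 SRC × L2 (b): the curvature term is `κ`-small -/
  curv : ∀ t ∈ Icc (0:ℝ) 1, |e t| ≤ κ * energyNorm (cavg L UB) X (periodBox (N * L ^ k)) ^ 2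
  /-- L9∕Y9 RES: the dual residual at the competitor's end -/
  res : φ' 1 ≤ r * energyNorm (cavg L UB) X (periodBox (N * L ^ k))

/-! ## §2 Folklore: gauge invariance of the Wilson action; minimality along the path -/

/-- The Wilson action of a window is GAUGE INVARIANT: `Σ(1 − Re tr V^u(∂p)) = Σ(1 − Re tr V(∂p))` (closed contours:
`V^u(∂p) = u(x)V(∂p)u(x)⁻¹`, B7 (8); cyclicity of the trace). [folklore] -/
theorem fineAction_gaugeAct (u : B7Prop1Explicit.Site d → (Matrix n n ℂ)ˣ)
    (V : B7Prop1Explicit.Site d → Fin d → (Matrix n n ℂ)ˣ) (W : Finset (T4AveragingDeficitWall.Plaq d)) :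
    fineAction (gaugeAct u V) W = fineAction V W := by
  unfold fineAction
  refine Finset.sum_congr rfl fun p _ => ?_
  unfold wt fhol
  rw [hol_gaugeAct_closed _ _ _ _ (disp_plaqWord _ _), Units.val_mul, Units.val_mul,
    nReTr_conj (Units.inv_mul (u p.1))]

/-- MINIMALITY ALONG THE PATH: under `RouteLeaves`, if `U_A` minimises run `k` (`IsMinimiser`, p204506) then
`φ 0 ≤ φ t` for `t ∈ [0,1]` — `φ 0 = A(U_A^u) = A(U_A)` (gauge invariance) and `A(U_A) ≤ A(W·exp Γ(t))` because the path
is admissible (`levelAction = (L^{4−d})^k · fineAction`, positive weight). [folklore] -/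
theorem RouteLeaves.min_along {𝒞 : ℕ → Set (B7Prop1Explicit.Site d → Fin d → (Matrix n n ℂ)ˣ)} {L N k : ℕ}
    (hL : 1 ≤ L) {V UA UB : B7Prop1Explicit.Site d → Fin d → (Matrix n n ℂ)ˣ}
    {u : B7Prop1Explicit.Site d → (Matrix n n ℂ)ˣ} {X : B7Prop1Explicit.Site d → Fin d → Matrix n n ℂ}
    {Γ : ℝ → B7Prop1Explicit.Site d → Fin d → Matrix n n ℂ} {φ φ' φ'' : ℝ → ℝ}
    {Hs : ℝ → (B7Prop1Explicit.Site d → Fin d → Matrix n n ℂ) →ₗ[ℝ]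
      (B7Prop1Explicit.Site d → Fin d → Matrix n n ℂ) →ₗ[ℝ] ℝ}
    {uu : ℝ → B7Prop1Explicit.Site d → Fin d → Matrix n n ℂ} {e : ℝ → ℝ}
    {T : Set (B7Prop1Explicit.Site d → Fin d → Matrix n n ℂ)} {c Λ θ κ θ₀ r : ℝ}
    (h : RouteLeaves 𝒞 L N k V UA UB u X Γ φ φ' φ'' Hs uu e T c Λ θ κ θ₀ r) (hA : IsMinimiser d 𝒞 L N k V UA) :
    ∀ t ∈ Ioo (0:ℝ) 1, φ 0 ≤ φ t := by
  intro t ht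
  have hc : 0 < ((stepWt d L)⁻¹) ^ k := pow_pos (inv_pos.mpr (stepWt_pos (d := d) L hL)) k
  have hle := hA.le _ (h.adm t (Ioo_subset_Icc_self ht))
  unfold MinimalActionLevels.levelAction at hle
  have hle' := le_of_mul_le_mul_left hle hc
  rw [h.act 0, h.act t, ← h.rep, fineAction_gaugeAct]
  exact hle'

/-! ## §3 The assembly: leaves ⇒ energy bound ⇒ the typed ROOT -/

/-- **LEAVES ⇒ THE ENERGY BOUND AT ONE PAIR.**  Under `RouteLeaves … c Λ θ κ θ₀ r` with `0 ≤ Λ`, `0 ≤ θ₀`, `0 ≤ r`,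
`0 < c` and the modulus budget `2Λθ + Λθ² + κ ≤ c/2`, if `U_A` minimises run `k`:
`energyNorm W (Γ 0) ≤ (1 + θ₀) · (2 r / c)` — `Support/NE3EnergyPath.energyResponse_of_pathData` BY NAME. [folklore] -/
theorem energyNorm_le_of_routeLeaves {𝒞 : ℕ → Set (B7Prop1Explicit.Site d → Fin d → (Matrix n n ℂ)ˣ)} {L N k : ℕ}
    (hL : 1 ≤ L) {V UA UB : B7Prop1Explicit.Site d → Fin d → (Matrix n n ℂ)ˣ}
    {u : B7Prop1Explicit.Site d → (Matrix n n ℂ)ˣ} {X : B7Prop1Explicit.Site d → Fin d → Matrix n n ℂ}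
    {Γ : ℝ → B7Prop1Explicit.Site d → Fin d → Matrix n n ℂ} {φ φ' φ'' : ℝ → ℝ}
    {Hs : ℝ → (B7Prop1Explicit.Site d → Fin d → Matrix n n ℂ) →ₗ[ℝ]
      (B7Prop1Explicit.Site d → Fin d → Matrix n n ℂ) →ₗ[ℝ] ℝ}
    {uu : ℝ → B7Prop1Explicit.Site d → Fin d → Matrix n n ℂ} {e : ℝ → ℝ}
    {T : Set (B7Prop1Explicit.Site d → Fin d → Matrix n n ℂ)} {c Λ θ κ θ₀ r : ℝ}
    (h : RouteLeaves 𝒞 L N k V UA UB u X Γ φ φ' φ'' Hs uu e T c Λ θ κ θ₀ r) (hA : IsMinimiser d 𝒞 L N k V UA)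
    (hΛ : 0 ≤ Λ) (hθ₀ : 0 ≤ θ₀) (hr : 0 ≤ r) (hc : 0 < c) (hbudget : 2 * Λ * θ + Λ * θ ^ 2 + κ ≤ c / 2) :
    energyNorm (cavg L UB) (Γ 0) (periodBox (N * L ^ k)) ≤ (1 + θ₀) * (2 * r / c) := by
  have hm : 0 < c - 2 * Λ * θ - Λ * θ ^ 2 - κ := by linarith
  have hX : energyNorm (cavg L UB) X (periodBox (N * L ^ k)) ≤ r / (c - 2 * Λ * θ - Λ * θ ^ 2 - κ) :=
    energyResponse_of_pathData Hs h.symm (fun Y => energyNorm (cavg L UB) Y (periodBox (N * L ^ k)))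
      (fun Y => energyNorm_nonneg _ Y _) T hΛ hr h.coer h.cont h.tangent uu h.velocity e h.curv h.d1 h.d2 h.split
      (h.min_along hL hA) h.res hm
  have hX' : energyNorm (cavg L UB) X (periodBox (N * L ^ k)) ≤ 2 * r / c :=
    NE3EnergyPath.energyResponse_half hc hr (modulus_ge_half hbudget) hX
  calc energyNorm (cavg L UB) (Γ 0) (periodBox (N * L ^ k))
      ≤ (1 + θ₀) * energyNorm (cavg L UB) X (periodBox (N * L ^ k)) := h.close
    _ ≤ (1 + θ₀) * (2 * r / c) := mul_le_mul_of_nonneg_left hX' (by linarith)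

/-- **LEAVES ⇒ THE TYPED ROOT.**  If for every level `k ≥ 1`, every datum `V ∈ dom` and every pair of minimisers
`(U_A, U_B)` with `U_B` `Regular b g (k+1)` the route's leaves hold with UNIFORM constants `(c, Λ, θ, κ, θ₀)` and the
residual constant `r = residualScale d L N b g k` (row Y9), under the budget and `c > 0`, then
`NE3EnergyRate 𝒞 L N b g ((1 + θ₀)·(2/c)) dom` — the skeleton's ROOT T-E, with the displayed modulus. [folklore] -/
theorem ne3EnergyRate_of_routeLeaves {𝒞 : ℕ → Set (B7Prop1Explicit.Site d → Fin d → (Matrix n n ℂ)ˣ)} {L N : ℕ}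
    (hL : 1 ≤ L) {b g : ℝ} {dom : Set (B7Prop1Explicit.Site d → Fin d → (Matrix n n ℂ)ˣ)} {c Λ θ κ θ₀ : ℝ}
    (hΛ : 0 ≤ Λ) (hθ₀ : 0 ≤ θ₀) (hc : 0 < c) (hbudget : 2 * Λ * θ + Λ * θ ^ 2 + κ ≤ c / 2)
    (hleaves : ∀ k : ℕ, 1 ≤ k → ∀ V ∈ dom, ∀ UA UB : B7Prop1Explicit.Site d → Fin d → (Matrix n n ℂ)ˣ,
      IsMinimiser d 𝒞 L N k V UA → IsMinimiser d 𝒞 L N (k + 1) V UB → Regular d L N b g (k + 1) UB →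
        ∃ (u : B7Prop1Explicit.Site d → (Matrix n n ℂ)ˣ) (X : B7Prop1Explicit.Site d → Fin d → Matrix n n ℂ)
          (Γ : ℝ → B7Prop1Explicit.Site d → Fin d → Matrix n n ℂ) (φ φ' φ'' : ℝ → ℝ)
          (Hs : ℝ → (B7Prop1Explicit.Site d → Fin d → Matrix n n ℂ) →ₗ[ℝ]
            (B7Prop1Explicit.Site d → Fin d → Matrix n n ℂ) →ₗ[ℝ] ℝ)
          (uu : ℝ → B7Prop1Explicit.Site d → Fin d → Matrix n n ℂ) (e : ℝ → ℝ)
          (T : Set (B7Prop1Explicit.Site d → Fin d → Matrix n n ℂ)),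
          RouteLeaves 𝒞 L N k V UA UB u X Γ φ φ' φ'' Hs uu e T c Λ θ κ θ₀ (residualScale d L N b g k)) :
    NE3EnergyRate d 𝒞 L N b g ((1 + θ₀) * (2 / c)) dom := by
  intro k hk V hV UA UB hA hB hreg
  obtain ⟨u, X, Γ, φ, φ', φ'', Hs, uu, e, T, h⟩ := hleaves k hk V hV UA UB hA hB hreg
  refine ⟨u, Γ 0, h.gauge.1, h.gauge.2, h.dirZ.1, h.dirZ.2, ?_, ?_⟩
  · rw [h.rep]; rfl
  · have hb := energyNorm_le_of_routeLeaves hL h hA hΛ hθ₀ (residualScale_nonneg d L N b g k) hc hbudget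
    have hcv : cavg L UB = rescale L (bavg L UB) := rfl
    rw [hcv] at hb
    refine hb.trans (le_of_eq ?_)
    ring

/-! ## §4 Non-vacuity: the leaves are jointly satisfiable (flat class, trivial path) -/

/-- **NON-VACUITY OF `RouteLeaves`**: in the flat class with the flat datum and the flat pair of configurations, the
trivial data — gauge `u = 1`, tangent direction `X = 0`, constant path `Γ ≡ 0`, constant action, zero Hessian forms,
zero corrections, tangent space `T = {0}` — satisfy every field for all constants with `Λ ≥ 0` (every inequality reads
`0 ≤ 0` or `c·0 ≤ 0`).  So the hypothesis structure is consistent; together with `NE3EnergyShapes.ne3EnergyRate_flat`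
the implication of §3 is exercised non-vacuously. [folklore] -/
theorem routeLeaves_flat [Nonempty n] (L N k : ℕ) (c Λ θ κ θ₀ r : ℝ) (hΛ : 0 ≤ Λ) :
    RouteLeaves (MinimalActionWitness.flatClass (d := d) (n := n)) L N k MinimalActionWitness.flatCfg
      MinimalActionWitness.flatCfg MinimalActionWitness.flatCfg (fun _ => 1) 0 (fun _ => 0)
      (fun _ => fineAction (MinimalActionWitness.flatCfg (d := d) (n := n)) (perWin d (N * L ^ k)))
      (fun _ => 0) (fun _ => 0) (fun _ => 0) (fun _ => 0) (fun _ => 0) {0} c Λ θ κ θ₀ r := by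
  have hW : cavg L (MinimalActionWitness.flatCfg (d := d) (n := n)) = MinimalActionWitness.flatCfg :=
    NE3EnergyShapes.rescale_bavg_flatCfg L
  have hN0 : energyNorm (cavg L (MinimalActionWitness.flatCfg (d := d) (n := n)))
      (0 : B7Prop1Explicit.Site d → Fin d → Matrix n n ℂ) (periodBox (N * L ^ k)) = 0 :=
    NE3EnergyShapes.energyNorm_zero _ _
  have hvary : ∀ t : ℝ, vary (cavg L (MinimalActionWitness.flatCfg (d := d) (n := n)))
      ((fun _ : ℝ => (0 : B7Prop1Explicit.Site d → Fin d → Matrix n n ℂ)) t) 1 = MinimalActionWitness.flatCfg := by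
    intro t; rw [hW]; exact vary_zero_dir _ _
  refine ⟨⟨fun _ => (unitaryUnits (Matrix n n ℂ)).one_mem, fun _ _ => rfl⟩, ?_, rfl, ⟨fun _ _ => (skewAdjoint _).zero_mem,
    fun _ _ _ => rfl⟩, ?_, Set.mem_singleton _, ?_, ?_, ?_, ?_, ?_, ?_, ?_, ?_, ?_, ?_, ?_⟩
  · rw [hvary 0, NE3EnergyShapes.gaugeAct_one]
  · intro t _; rw [hvary t]; exact MinimalActionWitness.flatCfg_mem_admissible L k
  · intro t _; rw [hN0]; simp
  · rw [hN0]; simp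
  · intro t; rw [hvary t]
  · intro t _; exact hasDerivAt_const t _
  · intro t _; exact hasDerivAt_const t _
  · intro t _ x y; simp
  · intro t _; simp
  · intro t _ Y hY
    rw [Set.mem_singleton_iff] at hY
    rw [hY, hN0]; simp
  · intro t _ Y Z
    simp only [LinearMap.zero_apply, abs_zero]
    exact mul_nonneg (mul_nonneg hΛ (energyNorm_nonneg _ _ _)) (energyNorm_nonneg _ _ _)
  · intro t _; rw [hN0]; simp
  · rw [hN0]; simp

/-! ## §5 The trivial pointwise corollary (volume-dependent constant) -/

/-- Every bond value is bounded by the energy norm: `‖Z(x,κ)‖ ≤ energyNorm W Z F` for `x ∈ F` (one term of `dirSq`).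
Hence ROOT T-E already gives a POINTWISE bound `‖Z(b)‖ ≤ C·residualScale` — a geometric rate `L^{−k}` with the
EXTENSIVE factor `N^{d/2}` (legitimate on the fixed torus, volume-dependent); the volume-free pointwise form is the
localisation consumer C-D of the skeleton. [folklore] -/
theorem norm_le_energyNorm (W : B7Prop1Explicit.Site d → Fin d → (Matrix n n ℂ)ˣ)
    (Z : B7Prop1Explicit.Site d → Fin d → Matrix n n ℂ) {F : Finset (B7Prop1Explicit.Site d)}
    {x : B7Prop1Explicit.Site d} (hx : x ∈ F) (κ : Fin d) : ‖Z x κ‖ ≤ energyNorm W Z F := by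
  unfold NE3EnergyShapes.energyNorm
  refine Real.le_sqrt_of_sq_le ?_
  have h1 : ‖Z x κ‖ ^ 2 ≤ ∑ μ : Fin d, ‖Z x μ‖ ^ 2 :=
    Finset.single_le_sum (f := fun μ => ‖Z x μ‖ ^ 2) (fun μ _ => sq_nonneg _) (Finset.mem_univ κ)
  have h2 : ∑ μ : Fin d, ‖Z x μ‖ ^ 2 ≤ dirSq Z F :=
    Finset.single_le_sum (f := fun y => ∑ μ : Fin d, ‖Z y μ‖ ^ 2) (fun y _ => by positivity) hx
  have h3 : 0 ≤ curlSq W Z F := by unfold curlSq; positivity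
  linarith


/-! ## §6 Consumer C-A: the action gap (the averaging deficit is the leading term of `A_k − A_{k+1}`) -/

/-- **C-A, THE ACTION GAP AT ONE PAIR**: under `RouteLeaves` (with the budget and `0 < c`), if `U_A` minimises
run `k`, the run-A level action of the competitor `W = cavg L U_B` exceeds the minimum by at most
`(L^{4−d})^{k}·r²/c`:  `0 ≤ A^{(k)}(W) − A^{(k)}(U_A) ≤ (stepWt⁻¹)^k · r²/c` (`NE3EnergyPath.actionGap_along_path` BY NAME:
the gap is at most the SQUARE of the dual residual over `2m`, `m ≥ c/2`).  With the owner's `levelAction_succ_eq`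
(p204337: `A^{(k+1)}(U_B) = A^{(k)}(W) − (stepWt⁻¹)^{k+1}·𝓓(U_B)`) this says: the averaging deficit `𝓓(U_B)` is the LEADING
TERM of `A_k(V) − A_{k+1}(V)` and the remainder is quadratic in the rate (`r = residualScale`: rate `L^{−2k}`, volume
`N^d`). [folklore] -/
theorem levelAction_gap_of_routeLeaves {𝒞 : ℕ → Set (B7Prop1Explicit.Site d → Fin d → (Matrix n n ℂ)ˣ)} {L N k : ℕ}
    (hL : 1 ≤ L) {V UA UB : B7Prop1Explicit.Site d → Fin d → (Matrix n n ℂ)ˣ}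
    {u : B7Prop1Explicit.Site d → (Matrix n n ℂ)ˣ} {X : B7Prop1Explicit.Site d → Fin d → Matrix n n ℂ}
    {Γ : ℝ → B7Prop1Explicit.Site d → Fin d → Matrix n n ℂ} {φ φ' φ'' : ℝ → ℝ}
    {Hs : ℝ → (B7Prop1Explicit.Site d → Fin d → Matrix n n ℂ) →ₗ[ℝ]
      (B7Prop1Explicit.Site d → Fin d → Matrix n n ℂ) →ₗ[ℝ] ℝ}
    {uu : ℝ → B7Prop1Explicit.Site d → Fin d → Matrix n n ℂ} {e : ℝ → ℝ}
    {T : Set (B7Prop1Explicit.Site d → Fin d → Matrix n n ℂ)} {c Λ θ κ θ₀ r : ℝ}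
    (h : RouteLeaves 𝒞 L N k V UA UB u X Γ φ φ' φ'' Hs uu e T c Λ θ κ θ₀ r) (hA : IsMinimiser d 𝒞 L N k V UA)
    (hΛ : 0 ≤ Λ) (hc : 0 < c) (hbudget : 2 * Λ * θ + Λ * θ ^ 2 + κ ≤ c / 2) :
    0 ≤ levelAction d L N k (cavg L UB) - levelAction d L N k UA ∧
      levelAction d L N k (cavg L UB) - levelAction d L N k UA ≤ ((stepWt d L)⁻¹) ^ k * (r ^ 2 / c) := by
  have hm : 0 < c - 2 * Λ * θ - Λ * θ ^ 2 - κ := by linarith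
  have hconv := strongConvexity_along_path Hs h.symm (fun Y => energyNorm (cavg L UB) Y (periodBox (N * L ^ k)))
    (fun Y => energyNorm_nonneg _ Y _) T hΛ h.coer h.cont h.tangent uu h.velocity e h.curv h.split
  obtain ⟨lo, up⟩ := NE3EnergyPath.actionGap_along_path h.d1 h.d2 hconv (h.min_along hL hA) h.res hm
  have hφ1 : φ 1 = fineAction (cavg L UB) (perWin d (N * L ^ k)) := by
    rw [h.act 1, h.endW]
    exact congrArg (fun U => fineAction U (perWin d (N * L ^ k))) (vary_zero_dir (cavg L UB) 1)
  have hφ0 : φ 0 = fineAction UA (perWin d (N * L ^ k)) := by rw [h.act 0, ← h.rep, fineAction_gaugeAct]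
  have hw : 0 < ((stepWt d L)⁻¹) ^ k := pow_pos (inv_pos.mpr (stepWt_pos (d := d) L hL)) k
  have hgap0 : 0 ≤ φ 1 - φ 0 :=
    le_trans (mul_nonneg (by linarith) (sq_nonneg _)) lo
  have hgap1 : φ 1 - φ 0 ≤ r ^ 2 / c := by
    refine up.trans ?_
    rw [div_le_div_iff₀ (by positivity) hc]
    nlinarith [sq_nonneg r]
  unfold MinimalActionLevels.levelAction
  rw [← mul_sub, ← hφ1, ← hφ0]
  exact ⟨mul_nonneg hw.le hgap0, mul_le_mul_of_nonneg_left hgap1 hw.le⟩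

end

end Summit.QuantumFields.BalabanUV.T4Continuum.NE3EnergyAssembly
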